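import Summits.Ventures.YMGap.Thresholds.StarFrontTorus
import HarnessLib

/-!
# Venture YMGap — track (c) «DS»: the star door in the crossover-ledger currency
# (`ExponentialClustering` / `StrongCouplingFront` of `SU(2)`), conditional on the star window bound

HONEST FRAMING: venture file (cell `pub-ymgap`), strong-coupling LATTICE bookkeeping only. INPUT: the
named hypothesis schema `StarWindowBound L β_W ρ r` of `StarWindow.lean` (the cell's Lemma S /
Lemma G propose an instance — pen-and-paper, NOT proved in the tree) with `ρ < 1`. OUTPUT,
kernel-checked GIVEN that input: `CrossoverLedger.ExponentialClustering (fundamentalRep (Fin 2))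
(β_W/2) (starRate ρ)` and `CrossoverLedger.StrongCouplingFront (fundamentalLatticeRep 2) (β₀W/2)`,
`starRate ρ = (1 − ρ)²/(2(16ρ + 1))` — the SAME currency and units as the tree's single-link front
`su2_strongCouplingFront_of_oneLinkKRModulus` (`β_W < 2/9`-class), so that a proof of the schema at
`β_W ≤ 11/40` (Lemma S) or `≤ 1/3` (Lemma G) is a like-for-like extension of that front. No
statement about the continuum, the mass gap, or any coupling where the hypothesis is not supplied.

Method: the one-torus covariance bound `su2Star_abs_integral_mul_sub_le` (`StarFrontTorus.lean`)
with `L₀ ≥ ‖x‖_∞ − D − 4` for supports of diameter `D` displaced by `x` (near/far split, the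
`Λ₂ = ∅` case, translation invariance of the torus Wilson state) — the skeleton of the tree's
`StrongCouplingTorusWindow.wilson_torusClustering_of_oneLinkKRModulus` /
`exponentialClustering_of_oneLinkKRModulus` with the star door in place of the single-link bound.

Contents: `su2Star_torusClustering` (`C e^{−κ‖x‖_∞}` on every torus of side `≥ 2` carrying the
bound, ONE constant), `su2Star_exponentialClustering`, `su2Star_strongCouplingFront`.
-/

noncomputable section

open MeasureTheory ProbabilityTheory Function Finset
open Literature.Probability.LatticeModels
open Literature.Probability.LatticeModels.DobrushinMetric
open Literature.MathematicalPhysics.QuantumLattice (toTorusObservable IsCylinder IsLocalObservable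
  LGConfig torusLift torusEdge groupHeatKernelMeasure fundamentalRep fundamentalLatticeRep)
open Literature.MathematicalPhysics.QuantumFieldTheory
open Literature.MathematicalPhysics.QuantumFieldTheory.Balaban1983to89
open Literature.MathematicalPhysics.QuantumFieldTheory.Balaban1983to89.StrongCouplingTorusWindow

namespace Summit.Ventures.YMGap.DSWindow

/-- **Volume-uniform exponential clustering from the star window bound** (`SU(2)`, `d = 4`, Wilson
coupling `β_W`, received sum `ρ < 1`): for all bounded measurable local observables `F₁, F₂` of
`ℤ⁴` there is ONE constant `C` such that on every torus of side `L ≥ 2` CARRYING the star window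
bound `StarWindowBound L β_W ρ suFrobDist`, and for every displacement with `2‖x‖_∞ < L`,
`|⟨F₁ · (F₂ ∘ θ_x)⟩_L − ⟨F₁⟩_L ⟨F₂ ∘ θ_x⟩_L| ≤ C e^{−κ(ρ) ‖x‖_∞}` under the torus Wilson measure at
tree coupling `β_W/2`
(Föllmer 1988 Ch. I Thm. (2.13) route; the star door replaces the single-link covariance bound of
the tree's `wilson_torusClustering_of_oneLinkKRModulus`). -/
theorem su2Star_torusClustering (βW : ℝ) {ρ : ℝ} (hρ0 : 0 ≤ ρ) (hρ1 : ρ < 1)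
    (F₁ F₂ : LGConfig 4 (Matrix.specialUnitaryGroup (Fin 2) ℂ) → ℝ)
    (h₁ : Literature.MathematicalPhysics.QuantumLattice.IsLocalObservable F₁)
    (h₂ : Literature.MathematicalPhysics.QuantumLattice.IsLocalObservable F₂) (h₁m : Measurable F₁)
    (h₂m : Measurable F₂) (hb₁ : ∃ C, ∀ U, |F₁ U| ≤ C) (hb₂ : ∃ C, ∀ U, |F₂ U| ≤ C) :
    ∃ C : ℝ, ∀ (L : ℕ) [NeZero L], 2 ≤ L → StarWindowBound L βW ρ suFrobDist →
      ∀ x : Literature.Probability.LatticeModels.Site 4, 2 * ‖x‖ < (L : ℝ) →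
      |(∫ V, toTorusObservable L (fun U => F₁ U * F₂ (Literature.MathematicalPhysics.QuantumLattice.configShift x U)) V
            ∂(wilsonMeasure (d := 4) (L := L) (fundamentalRep (Fin 2)) (βW / 2))) -
          (∫ V, toTorusObservable L F₁ V
            ∂(wilsonMeasure (d := 4) (L := L) (fundamentalRep (Fin 2)) (βW / 2))) *
            ∫ V, toTorusObservable L (F₂ ∘ Literature.MathematicalPhysics.QuantumLattice.configShift x) V
              ∂(wilsonMeasure (d := 4) (L := L) (fundamentalRep (Fin 2)) (βW / 2))| ≤
        C * Real.exp (-(starRate ρ * ‖x‖)) := by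
  classical
  obtain ⟨Λ₁, hΛ₁⟩ := h₁
  obtain ⟨Λ₂, hΛ₂⟩ := h₂
  obtain ⟨M₁, hM₁⟩ := hb₁
  obtain ⟨M₂, hM₂⟩ := hb₂
  have hκ0 : 0 < starRate ρ := starRate_pos hρ0 hρ1
  have hM₁0 : 0 ≤ M₁ := (abs_nonneg _).trans (hM₁ fun _ => 1)
  have hM₂0 : 0 ≤ M₂ := (abs_nonneg _).trans (hM₂ fun _ => 1)
  have hE0 : 0 ≤ wilsonSmoothLip 2 4 (βW / 2) := wilsonSmoothLip_nonneg (by norm_num) 4 _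
  -- the diameter of the two supports and the constant
  set D : ℕ := (Λ₁ ×ˢ Λ₂).sup fun ab =>
    Literature.Probability.LatticeModels.Site.supNorm (ab.1.1 - ab.2.1) with hDdef
  set K' : ℝ := Real.exp (starRate ρ * ((D + 4 : ℕ) : ℝ)) with hK'def
  have hK'0 : 0 < K' := Real.exp_pos _
  have hK'1 : 1 ≤ K' := Real.one_le_exp (by positivity)
  set J : ℝ := ((1 + 4 * (2 * (4 - 1)) : ℕ) : ℝ) with hJdef
  have hJ0 : 0 ≤ J := by rw [hJdef]; exact Nat.cast_nonneg _
  set E : ℝ := wilsonSmoothLip 2 4 (βW / 2)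
  refine ⟨2 * M₁ * M₂ * K' + 4 * (2 * Real.sqrt 2) ^ 2 * K' * ((Λ₁.card * J) * (M₁ * E)) *
    ((Λ₂.card * J) * (M₂ * E)), fun L _ hL hSL x hx => ?_⟩
  have hL1 : 1 < L := by omega
  haveI : SecondCountableTopology (Matrix (Fin 2) (Fin 2) ℂ) :=
    inferInstanceAs (SecondCountableTopology (Fin 2 → Fin 2 → ℂ))
  haveI : SecondCountableTopology (Matrix.specialUnitaryGroup (Fin 2) ℂ) :=
    Topology.IsEmbedding.subtypeVal.secondCountableTopology
  set μ := wilsonMeasure (d := 4) (L := L) (fundamentalRep (Fin 2)) (βW / 2) with hμdef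
  haveI : IsProbabilityMeasure μ := by
    have hG : IsGibbsMeasure (torusWeightSpec (d := 4) (L := L) (wilsonPlaqWeight 2 (βW / 2))) μ := by
      rw [hμdef, wilsonMeasure_eq_groupHeatKernelMeasure (βW / 2)]
      exact isGibbsMeasure_groupHeatKernelMeasure (continuous_wilsonPlaqWeight (N := 2) _)
        (wilsonPlaqWeight_pos (N := 2) _)
    exact hG.isProbabilityMeasure
  -- the observables on the torus of side `L`
  set f : GaugeConfig 4 L (Matrix.specialUnitaryGroup (Fin 2) ℂ) → ℝ := toTorusObservable L F₁
  set g : GaugeConfig 4 L (Matrix.specialUnitaryGroup (Fin 2) ℂ) → ℝ :=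
    toTorusObservable L (F₂ ∘ Literature.MathematicalPhysics.QuantumLattice.configShift x)
  have hfm : Measurable f := h₁m.comp (measurable_torusLift L)
  have hgm : Measurable g :=
    (h₂m.comp (Literature.MathematicalPhysics.QuantumLattice.configShift x).measurable).comp (measurable_torusLift L)
  have hfdep := dependsOn_toTorusObservable (G := Matrix.specialUnitaryGroup (Fin 2) ℂ) L hΛ₁
  have hgdep := dependsOn_toTorusObservable_configShift
    (G := Matrix.specialUnitaryGroup (Fin 2) ℂ) L hΛ₂ x
  have hMf : ∀ σ, |f σ| ≤ M₁ := fun σ => hM₁ _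
  have hMg : ∀ σ, |g σ| ≤ M₂ := fun σ => hM₂ _
  rw [show (∫ V, toTorusObservable L (fun U => F₁ U * F₂ (Literature.MathematicalPhysics.QuantumLattice.configShift x U)) V ∂μ) =
    ∫ V, f V * g V ∂μ from rfl]
  set Δf : Finset (Edge 4 L) := Λ₁.image (torusEdge L)
  set Δg : Finset (Edge 4 L) := Λ₂.image fun e => torusEdge L (e.1 - x, e.2) with hΔg
  have hfdep' : DependsOn f (↑Δf : Set (Edge 4 L)) := hfdep
  have hgdep' : DependsOn g (↑Δg : Set (Edge 4 L)) := hgdep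
  have hxL : 2 * Literature.Probability.LatticeModels.Site.supNorm x < L := by
    rw [Literature.Probability.LatticeModels.Site.norm_eq_supNorm] at hx
    exact_mod_cast hx
  set nx : ℕ := Literature.Probability.LatticeModels.Site.supNorm x with hnx
  have hnorm : ‖x‖ = (nx : ℝ) := Literature.Probability.LatticeModels.Site.norm_eq_supNorm x
  rw [hnorm]
  -- the trivial bound `|cov| ≤ 2 M₁ M₂`
  have htriv : |(∫ V, f V * g V ∂μ) - (∫ V, f V ∂μ) * ∫ V, g V ∂μ| ≤ 2 * M₁ * M₂ := by
    calc |(∫ V, f V * g V ∂μ) - (∫ V, f V ∂μ) * ∫ V, g V ∂μ|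
        ≤ |∫ V, f V * g V ∂μ| + |(∫ V, f V ∂μ) * ∫ V, g V ∂μ| := abs_sub _ _
      _ ≤ M₁ * M₂ + M₁ * M₂ := by
          refine add_le_add (abs_integral_le_of_abs_le (abs_mul_le_of_abs_le hMf hMg)) ?_
          rw [abs_mul]
          exact mul_le_mul (abs_integral_le_of_abs_le hMf) (abs_integral_le_of_abs_le hMg)
            (abs_nonneg _) hM₁0
      _ = 2 * M₁ * M₂ := by ring
  have hsecond0 : 0 ≤ 4 * (2 * Real.sqrt 2) ^ 2 * K' * ((Λ₁.card * J) * (M₁ * E)) *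
      ((Λ₂.card * J) * (M₂ * E)) := by positivity
  by_cases hnear : nx < D + 4
  · -- NEAR: `K' e^{-κ ‖x‖} ≥ 1`
    have hone : 1 ≤ K' * Real.exp (-(starRate ρ * nx)) := by
      rw [hK'def, ← Real.exp_add]
      refine Real.one_le_exp ?_
      have : (nx : ℝ) ≤ ((D + 4 : ℕ) : ℝ) := by exact_mod_cast hnear.le
      nlinarith
    refine htriv.trans ?_
    calc 2 * M₁ * M₂ ≤ 2 * M₁ * M₂ * (K' * Real.exp (-(starRate ρ * nx))) :=
          le_mul_of_one_le_right (by positivity) hone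
      _ ≤ (2 * M₁ * M₂ * K' + 4 * (2 * Real.sqrt 2) ^ 2 * K' * ((Λ₁.card * J) * (M₁ * E)) *
            ((Λ₂.card * J) * (M₂ * E))) * Real.exp (-(starRate ρ * nx)) := by
          rw [add_mul]
          exact le_add_of_le_of_nonneg (le_of_eq (by ring)) (by positivity)
  -- FAR: `D + 4 ≤ ‖x‖_∞`; the plaquette closure of `Δf` misses `Δg`
  rw [not_lt] at hnear
  have hgeom : ∀ a ∈ Λ₁, ∀ b ∈ Λ₂,
      nx ≤ torusNorm ((torusEdge L a).1 - (torusEdge L (b.1 - x, b.2)).1) + D := by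
    intro a ha b hb
    have hs := supNorm_le_torusNorm_add (L := L) (a := a.1) (b := b.1) hxL
    have hDab : Literature.Probability.LatticeModels.Site.supNorm (a.1 - b.1) ≤ D := by
      rw [hDdef]
      exact Finset.le_sup (f := fun ab : Literature.MathematicalPhysics.QuantumLattice.ZdEdge 4 ×
          Literature.MathematicalPhysics.QuantumLattice.ZdEdge 4 =>
        Literature.Probability.LatticeModels.Site.supNorm (ab.1.1 - ab.2.1))
        (Finset.mk_mem_product ha hb)
    exact hs.trans (Nat.add_le_add_left hDab _)
  have hsep : ∀ y ∈ plaqClosure Δf, y ∉ Δg := by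
    intro y hy hyg
    obtain ⟨y₀, hy₀, hyy₀⟩ := exists_near_of_mem_plaqClosure hy
    obtain ⟨a, ha, rfl⟩ := Finset.mem_image.1 hy₀
    obtain ⟨b, hb, rfl⟩ := Finset.mem_image.1 hyg
    have h1 : torusNorm ((torusEdge L a).1 - (torusEdge L (b.1 - x, b.2)).1) ≤ 1 := by
      rw [← torusNorm_neg, neg_sub]; exact hyy₀
    have h2 := hgeom a ha b hb
    omega
  by_cases hΛ₂e : Λ₂ = ∅
  · -- `F₂` is constant on the torus: the covariance vanishes
    have hΔg0 : Δg = ∅ := by rw [hΔg, hΛ₂e, Finset.image_empty]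
    set V₁ : GaugeConfig 4 L (Matrix.specialUnitaryGroup (Fin 2) ℂ) := fun _ => 1
    have hgc : ∀ V, g V = g V₁ := fun V => hgdep' fun i hi => by simp [hΔg0] at hi
    have hI1 : ∫ V, f V * g V ∂μ = (∫ V, f V ∂μ) * g V₁ := by
      rw [← integral_mul_const]
      exact integral_congr_ae (ae_of_all _ fun V => by simp only [hgc V])
    have hI2 : ∫ V, g V ∂μ = g V₁ := by
      have h := integral_congr_ae (μ := μ) (ae_of_all μ fun V => hgc V)
      rw [integral_const, smul_eq_mul, probReal_univ, one_mul] at h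
      exact h
    have hI : (∫ V, f V * g V ∂μ) - (∫ V, f V ∂μ) * ∫ V, g V ∂μ = 0 := by rw [hI1, hI2, sub_self]
    rw [hI, abs_zero]
    positivity
  -- the endpoint distance between the two plaquette closures is `≥ ‖x‖_∞ − D − 4`
  have hL₀ : ∀ y ∈ plaqClosure Δf, ∀ z ∈ plaqClosure Δg, ∀ a ∈ linkEnds y, ∀ w ∈ linkEnds z,
      nx - (D + 4) ≤ torusNorm (a - w) := by
    intro y hy z hz a ha w hw
    obtain ⟨y₀, hy₀, hyy₀⟩ := exists_near_of_mem_plaqClosure hy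
    obtain ⟨a₀, ha₀, rfl⟩ := Finset.mem_image.1 hy₀
    obtain ⟨z₀, hz₀, hzz₀⟩ := exists_near_of_mem_plaqClosure hz
    obtain ⟨b₀, hb₀, rfl⟩ := Finset.mem_image.1 hz₀
    have h2 := hgeom a₀ ha₀ b₀ hb₀
    have htri : torusNorm ((torusEdge L a₀).1 - (torusEdge L (b₀.1 - x, b₀.2)).1) ≤
        1 + 1 + torusNorm (a - w) + 1 + 1 := by
      calc torusNorm ((torusEdge L a₀).1 - (torusEdge L (b₀.1 - x, b₀.2)).1)
          ≤ torusNorm ((torusEdge L a₀).1 - y.1) + torusNorm (y.1 - (torusEdge L (b₀.1 - x, b₀.2)).1) :=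
            torusNorm_sub_le _ _ _
        _ ≤ torusNorm ((torusEdge L a₀).1 - y.1) + (torusNorm (y.1 - a) +
            torusNorm (a - (torusEdge L (b₀.1 - x, b₀.2)).1)) :=
            Nat.add_le_add_left (torusNorm_sub_le _ _ _) _
        _ ≤ torusNorm ((torusEdge L a₀).1 - y.1) + (torusNorm (y.1 - a) +
            (torusNorm (a - w) + torusNorm (w - (torusEdge L (b₀.1 - x, b₀.2)).1))) :=
            Nat.add_le_add_left (Nat.add_le_add_left (torusNorm_sub_le _ _ _) _) _
        _ ≤ torusNorm ((torusEdge L a₀).1 - y.1) + (torusNorm (y.1 - a) +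
            (torusNorm (a - w) + (torusNorm (w - z.1) + torusNorm (z.1 - (torusEdge L (b₀.1 - x, b₀.2)).1)))) :=
            Nat.add_le_add_left (Nat.add_le_add_left (Nat.add_le_add_left (torusNorm_sub_le _ _ _) _) _) _
        _ ≤ 1 + (1 + (torusNorm (a - w) + (1 + 1))) := by
            refine Nat.add_le_add ?_ (Nat.add_le_add (torusNorm_fst_sub_linkEnds_le_one y ha)
              (Nat.add_le_add_left (Nat.add_le_add ?_ hzz₀) _))
            · rw [← torusNorm_neg, neg_sub]; exact hyy₀
            · rw [← torusNorm_neg, neg_sub]; exact torusNorm_fst_sub_linkEnds_le_one z hw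
        _ = 1 + 1 + torusNorm (a - w) + 1 + 1 := by ring
    omega
  have key := su2Star_abs_integral_mul_sub_le hL1 βW hρ0 hρ1 hSL hfm hfdep' hMf hgm hgdep'
    hMg hsep (nx - (D + 4)) hL₀
  refine key.trans ?_
  -- `e^{-κ L₀} ≤ K' e^{-κ ‖x‖}`
  have hexp : Real.exp (-(starRate ρ * ((nx - (D + 4) : ℕ) : ℝ))) ≤
      K' * Real.exp (-(starRate ρ * nx)) := by
    rw [hK'def, ← Real.exp_add]
    refine Real.exp_le_exp.2 ?_
    have : ((nx - (D + 4) : ℕ) : ℝ) = (nx : ℝ) - ((D + 4 : ℕ) : ℝ) := by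
      rw [Nat.cast_sub hnear]
    rw [this]
    nlinarith
  have hcardf : ((plaqClosure Δf).card : ℝ) ≤ Λ₁.card * J := by
    have h1 : ((plaqClosure Δf).card : ℝ) ≤ Δf.card * J := by
      rw [hJdef]; exact_mod_cast card_plaqClosure_le Δf
    have h2 : (Δf.card : ℝ) ≤ Λ₁.card := by exact_mod_cast Finset.card_image_le
    exact h1.trans (mul_le_mul_of_nonneg_right h2 hJ0)
  have hcardg : ((plaqClosure Δg).card : ℝ) ≤ Λ₂.card * J := by
    have h1 : ((plaqClosure Δg).card : ℝ) ≤ Δg.card * J := by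
      rw [hJdef]; exact_mod_cast card_plaqClosure_le Δg
    have h2 : (Δg.card : ℝ) ≤ Λ₂.card := by exact_mod_cast Finset.card_image_le
    exact h1.trans (mul_le_mul_of_nonneg_right h2 hJ0)
  calc 4 * (2 * Real.sqrt 2) ^ 2 * Real.exp (-(starRate ρ * ((nx - (D + 4) : ℕ) : ℝ))) *
        ((plaqClosure Δf).card * (M₁ * E)) * ((plaqClosure Δg).card * (M₂ * E))
      ≤ 4 * (2 * Real.sqrt 2) ^ 2 * (K' * Real.exp (-(starRate ρ * nx))) *
        ((Λ₁.card * J) * (M₁ * E)) * ((Λ₂.card * J) * (M₂ * E)) := by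
        gcongr
    _ = (4 * (2 * Real.sqrt 2) ^ 2 * K' * ((Λ₁.card * J) * (M₁ * E)) * ((Λ₂.card * J) * (M₂ * E))) *
          Real.exp (-(starRate ρ * nx)) := by ring
    _ ≤ (2 * M₁ * M₂ * K' + 4 * (2 * Real.sqrt 2) ^ 2 * K' * ((Λ₁.card * J) * (M₁ * E)) *
          ((Λ₂.card * J) * (M₂ * E))) * Real.exp (-(starRate ρ * nx)) := by
        rw [add_mul]
        exact le_add_of_nonneg_left (by positivity)

/-- **The crossover-ledger clustering currency from the star window bound** (`SU(2)`, `d = 4`): if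
every odd torus of side `2S+1 ≥ 2S₀+1` carries `StarWindowBound (2S+1) β_W ρ suFrobDist` with
`ρ < 1`, then `CrossoverLedger.ExponentialClustering (fundamentalRep (Fin 2)) (β_W/2) (κ(ρ))`,
`κ(ρ) = (1 − ρ)²/(2(16ρ + 1))` (translation invariance of the torus Wilson state identifies
`⟨B ∘ θ⟩ = ⟨B⟩`, as in the tree's `exponentialClustering_of_oneLinkKRModulus`). The hypothesis is the
cell's Lemma S/G — NOT proved here. -/
theorem su2Star_exponentialClustering (βW : ℝ) {ρ : ℝ} (hρ0 : 0 ≤ ρ) (hρ1 : ρ < 1) (S₀ : ℕ)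
    (hS : ∀ S : ℕ, S₀ ≤ S → StarWindowBound (2 * S + 1) βW ρ suFrobDist) :
    CrossoverLedger.ExponentialClustering (G := Matrix.specialUnitaryGroup (Fin 2) ℂ)
      (fundamentalRep (Fin 2)) (βW / 2) (starRate ρ) := by
  refine ⟨starRate_pos hρ0 hρ1, fun A B => ?_⟩
  obtain ⟨C, hC⟩ := su2Star_torusClustering βW hρ0 hρ1 A.F B.F ⟨A.supp, A.isCylinder⟩
    ⟨B.supp, B.isCylinder⟩ A.measurable B.measurable A.bounded B.bounded
  refine ⟨C, S₀ + 1, fun S hS₀ n hn => ?_⟩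
  have hL2 : 2 ≤ 2 * S + 1 := by omega
  have hSS : S₀ ≤ S := by omega
  set x : Literature.Probability.LatticeModels.Site 4 := -Pi.single (0 : Fin 4) (n : ℤ)
  have hxn : ‖x‖ = n := norm_neg_single_natCast n
  have hx2 : 2 * ‖x‖ < ((2 * S + 1 : ℕ) : ℝ) := by
    rw [hxn]; push_cast
    have : (n : ℝ) ≤ S := by exact_mod_cast hn
    linarith
  have h := hC (2 * S + 1) hL2 (hS S hSS) x hx2
  rw [hxn] at h
  -- translation invariance: `⟨B ∘ θ_x⟩ = ⟨B⟩`
  have htrans : ∫ V, toTorusObservable (2 * S + 1) (B.F ∘ Literature.MathematicalPhysics.QuantumLattice.configShift x) V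
      ∂(wilsonMeasure (d := 4) (L := 2 * S + 1) (fundamentalRep (Fin 2)) (βW / 2)) =
      ∫ V, toTorusObservable (2 * S + 1) B.F V
        ∂(wilsonMeasure (d := 4) (L := 2 * S + 1) (fundamentalRep (Fin 2)) (βW / 2)) := by
    rw [toTorusObservable_comp_configShift]
    simp only [Function.comp_apply]
    rw [← integral_map_equiv, wilsonMeasure_map_torusConfigShift]
  rw [htrans] at h
  exact h

/-- **The strong-coupling front of the crossover ledger from the star window bound** (`SU(2)`,
Wilson units): if for every Wilson coupling `0 ≤ β_W ≤ β₀W` every large odd torus carries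
`StarWindowBound (2S+1) β_W ρ suFrobDist` with one `ρ < 1` (cell: `ρ = starR β₀W …`, monotone in
`β_W`), then `CrossoverLedger.StrongCouplingFront (fundamentalLatticeRep 2) (β₀W/2)` with the single
rate `κ(ρ)` — the SAME currency and units as the tree's single-link front
`su2_strongCouplingFront_of_oneLinkKRModulus` (tree coupling `β₀W/2`, 't Hooft `β₀W/4`). The cell's
target: `β₀W = 1/4`, then `11/40` (Lemma S) / `1/3` (Lemma G); the hypothesis is NOT proved here. -/
theorem su2Star_strongCouplingFront (β₀W : ℝ) {ρ : ℝ} (hρ0 : 0 ≤ ρ) (hρ1 : ρ < 1) (S₀ : ℕ)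
    (hS : ∀ βW : ℝ, 0 ≤ βW → βW ≤ β₀W → ∀ S : ℕ, S₀ ≤ S →
      StarWindowBound (2 * S + 1) βW ρ suFrobDist) :
    CrossoverLedger.StrongCouplingFront (fundamentalLatticeRep 2) (β₀W / 2) := by
  refine ⟨starRate ρ, starRate_pos hρ0 hρ1, fun β hβ0 hββ₀ => ?_⟩
  have h := su2Star_exponentialClustering (2 * β) hρ0 hρ1 S₀
    (hS (2 * β) (by linarith) (by linarith))
  have e : 2 * β / 2 = β := by ring
  rw [e] at h
  exact h

end Summit.Ventures.YMGap.DSWindow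

end
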